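import Summits.Ventures.DiscreteObjects.Hadamard.AutomorphismTransfer668B

/-!
# Hadamard 668 census, family F12 — summary theorem: the prime orders of automorphisms of H(668) lie in
# {2, 3, 5, 7, 11, 13, 23, 29, 37, 41, 83, 167} (kernel)

Framing: lottery ticket; floor = certified bounds/negative ranges.

Cell pub-namedobj (venture DiscreteObjects), target (H), hadamard gen 6.  One quotable statement assembling the kernel chain
p232555 → p233702 → p234638 → p235022 → p235472: **if a Hadamard matrix `H` of order `668` (tree `IsHadamardMatrix`) admits a
signed-permutation automorphism `(π, κ, d, e)` (`H (π i) (κ j) = d i · e j · H i j`, signs `±1`) with `π^p = κ^p = 1`,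
`(π, κ) ≠ (1, 1)` and `p` prime, then `p ∈ {2, 3, 5, 7, 11, 13, 23, 29, 37, 41, 83, 167}`** (`hadamard668_signedAut_prime_mem`).
Ingredients: primes `p > 668` cannot act (`perm_eq_one_of_card_lt`: an orbit of a moved point has `p` elements); the primes
`p ≤ 668` are `2`, the eleven listed odd primes, the 106 primes of `primes106`, or `17, 19, 31, 47` (`primes_le_668_cases`,
`decide` over `n ≤ 668` with an explicit small divisor for the composites — no primality test in the kernel); the latter two groups are excluded by
`no_hadamard668_signedAut_primes109`.  What is NOT claimed: `2` and `167` do occur in known families' analogues and are not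
analysed; `3, 5, 7, 11, 13, 23, 37, 41, 83` survive every test of the census; `29` is excluded on paper only (Lander's parity
theorem, see `PrimeOrder29`).  Ours, not literature; no `sorry`.
-/

open Finset BigOperators Matrix

namespace Summit.Ventures.DiscreteObjects.Hadamard

open Literature.Combinatorics.Designs.GoethalsSeidel (IsHadamardMatrix)

/-- a permutation with `σ^p = 1`, `p` prime, on fewer than `p` elements is the identity -/
lemma perm_eq_one_of_card_lt {α : Type*} [Fintype α] [DecidableEq α] (σ : Equiv.Perm α) {p : ℕ} (hp : p.Prime)
    (hσ : σ ^ p = 1) (h : Fintype.card α < p) : σ = 1 := by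
  ext a
  by_contra hne
  have h1 := card_orbFin σ hp hσ hne
  have h2 : (orbFin σ p a).card ≤ Fintype.card α := Finset.card_le_univ _
  omega

/-- the primes that the census does not exclude for H(668) (plus `29`, excluded on paper only) -/
def spectrum668 : Finset ℕ := {2, 3, 5, 7, 11, 13, 23, 29, 37, 41, 83, 167}

set_option maxRecDepth 200000 in
/-- every `n ≤ 668` is in `spectrum668`, in `primes106`, one of `17, 19, 31, 47`, or visibly composite / `< 2`
(a divisor `2 ≤ d ≤ 25` is exhibited; `26² > 668`) — cheap for the kernel, no primality test is evaluated -/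
lemma range669_cases : ∀ n ∈ Finset.range 669,
    n ∈ spectrum668 ∨ n ∈ primes106 ∨ (n = 17 ∨ n = 19 ∨ n = 31 ∨ n = 47) ∨ n < 2 ∨
      ∃ d ∈ Finset.range 26, 2 ≤ d ∧ d < n ∧ n % d = 0 := by
  decide

/-- every prime `p ≤ 668` is in `spectrum668`, in `primes106`, or one of `17, 19, 31, 47` -/
lemma primes_le_668_cases (p : ℕ) (hp669 : p ∈ Finset.range 669) (hp : p.Prime) :
    p ∈ spectrum668 ∨ p ∈ primes106 ∨ (p = 17 ∨ p = 19 ∨ p = 31 ∨ p = 47) := by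
  rcases range669_cases p hp669 with h | h | h | h | ⟨d, -, hd2, hdp, hmod⟩
  · exact Or.inl h
  · exact Or.inr (Or.inl h)
  · exact Or.inr (Or.inr h)
  · exact absurd hp.two_le (by omega)
  · exfalso
    have hdvd : d ∣ p := Nat.dvd_of_mod_eq_zero hmod
    rcases (Nat.dvd_prime hp).mp hdvd with h1 | h2 <;> omega

/-- **Summary.** The prime orders available to signed-permutation automorphisms of a Hadamard matrix of order `668` lie in
`{2, 3, 5, 7, 11, 13, 23, 29, 37, 41, 83, 167}`. -/
theorem hadamard668_signedAut_prime_mem {ι : Type*} [Fintype ι] [DecidableEq ι] {H : Matrix ι ι ℤ}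
    (hH : IsHadamardMatrix H) (hι : Fintype.card ι = 668) (p : ℕ) (hp : p.Prime)
    (π κ : Equiv.Perm ι) (d e : ι → ℤ) (haut : IsSignedAut H π κ d e)
    (hπ : π ^ p = 1) (hκ : κ ^ p = 1) (hne : π ≠ 1 ∨ κ ≠ 1) : p ∈ spectrum668 := by
  by_cases hlt : 668 < p
  · exfalso
    have hcard : Fintype.card ι < p := by rw [hι]; exact hlt
    rcases hne with h | h
    · exact h (perm_eq_one_of_card_lt π hp hπ hcard)
    · exact h (perm_eq_one_of_card_lt κ hp hκ hcard)
  · have hmem : p ∈ Finset.range 669 := Finset.mem_range.mpr (by omega)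
    rcases primes_le_668_cases p hmem hp with h | h | h
    · exact h
    · by_cases h167 : p = 167
      · subst h167; decide
      · exact (no_hadamard668_signedAut_primes109 hH hι p hp (Or.inl h) h167 π κ d e haut hπ hκ hne).elim
    · have h167 : p ≠ 167 := by omega
      exact (no_hadamard668_signedAut_primes109 hH hι p hp (Or.inr h) h167 π κ d e haut hπ hκ hne).elim

end Summit.Ventures.DiscreteObjects.Hadamard
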